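import Summits.QuantumFields.BalabanUV.T4Continuum.Support.NE7CovDivB8Letter
import Summits.QuantumFields.BalabanUV.T4Continuum.Support.NE7CriticalFirstVariationGeneral
import HarnessLib

/-!
# NE7CovDivGeneralDatum — [B8] (1.9) ∕ [B11] (2)'s SMALL-CURRENT CLAUSE FOR OUR TANGENT-CRITICAL CONFIGURATIONS OVER GENERAL DATA: the covariant current
# `‖(D*_U ∂U)(b)‖` of a tangent-critical admissible configuration of the small-field class is `≲ card n·(a·C·(L∕L^d)^{k+1}·M^{d−2} + a²)` at every bond, in every
# unitary gauge — R2–R4 of gen 72 (`NE7CriticalTensionLetter` ∕ `NE7TensionGaugeLetter` ∕ `NE7CovDivB8Letter`, flat top) with the flat-top first-variation letter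
# replaced by the GENERAL-DATUM one (`NE7CriticalFirstVariationGeneral.abs_dAction_le_of_tanCritical_general`)

Cell `pub-balaban`, rung (B)+1 sub-cell t4, lineage `b2b-balaban-t4-ne7-p1` (CRUX PROVER NE7 #1 = OWNER of row NE7), generation 91; memo
`t4/b2b-balaban-t4-ne7-p1-g91/COVER-OBSTRUCTION.md` §6.

WHY.  After F291–F295 the NE7-specific bill of route 1's END is (REG9)∕(PG) — [Balaban1985Variational] Thm 1 (9)–(10) TYPE regularity of OUR tangent-critical admissible
configuration.  Bałaban's space (2) in which Thm 1 lives asks small plaquettes AND a small covariant current `|(D*_U ∂U)(b)| < ε₀η²(L^jη)^{−3}`; our class has only the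
plaquettes.  This file supplies the current clause for OUR configurations over an ARBITRARY datum: the gen-72 chain R2 (pointwise tension from the integrated
criticality letter by one-bond test directions) → R3 (any unitary gauge) → R4 (lit-balaban's `B8Ineq132.covDiv`, (1.2) literally) is verbatim, its only flat-top
input `abs_dAction_le_of_tanCritical` being replaced by `abs_dAction_le_of_tanCritical_general` (any admissible datum; constant
`a·(curl1C∕(1−θ_loc·M²x))·M^{d−2}·e^{(L^d∕L)·d·16(d+1)(d+4)L²·(1250(nbRad+L)+8dL+2L)·(2∕twoLevelSmall)}·(L∕L^d)^{k+1}`, i.e. `≍ a∕M = δ∕M³` at `a = δ∕M²`, `d + 1 = 4`… in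
dimension `d`: `M^{d−2}·M^{1−d} = M^{−1}`).
WHAT ([folklore]; 0 def, 0 sorry; every dimension `d`).  `abs_tension_pairing_le_of_tanCritical_gen`, `norm_tension_le_of_tanCritical_gen`,
`norm_tension_gaugeAct_le_of_tanCritical_gen`, **`norm_covDiv_le_of_tanCritical_gen`** — R2, R2-pointwise, R3, R4 over a general datum.
HONEST FRAMING (page 1): the (1.9)∕(2)-current INPUT for our configurations, NOT [B8] Thm 2 nor [B11] Thm 1; (REG9)∕(PG), hleaves NOT proved; NE7 NOT PROVED; nothing
of Bałaban's asserted; spine 0∕9; finite T⁴ rung (B)+1 — NOT infinite volume, NOT mass gap, NOT `BetaPertH`, NOT Clay.  Continuum YM on T⁴ ⇐ BetaPertH ∧ nine spine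
estimates (0/9 proved); BetaPertH ⇐ (D1) ∧ (D4) ∧ CAP+tail; G-an2-4 gates asym, D1 and NE2/3/4.  No `sorry`; axioms ⊆ {propext, Classical.choice, Quot.sound}.
-/

set_option autoImplicit false

open scoped BigOperators Matrix.Norms.L2Operator
open NormedSpace Finset

namespace Summit.QuantumFields.BalabanUV.T4Continuum.NE7CovDivGeneralDatum

open Literature.MathematicalPhysics.QuantumFieldTheory.Balaban1983to89
open B7Prop1Explicit B7Prop2Explicit MatrixLog UnitaryModel MatrixNorms
open B8Ineq132 (plaqF covDeriv covDiv)
open T4AveragingDeficitWall (IsUnitaryCfg IsSkewDir SmallField dirL1 Ad flux fhol)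
open T4AveragingDeficitWallBoundary (IsPeriodicCfg periodBox mem_periodBox)
open AveragingDeficitTransport (norm_Ad_of_unitary Ad_mem_skewAdjoint)
open AveragingDeficitPeriodicCounting (IsPeriodicDir)
open AveragingDeficitTwoLevelPrep (twoLevelSmall)
open AveragingDeficitMultiLevelPrep (cavgIter LevelSmall)
open AveragingDeficitKDatum (isUnitaryCfg_gaugeAct)
open BlockAverageCurrent (smallField_gaugeAct)
open BlockAverageVaryHolo (nbRad)
open MinimalActionLevels (perWin)
open BlockAveragePushDirSplit (flat)
open NE3TangentCovariantTower (dirIter QbarIter)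
open NE3HessForm (dAction)
open NE3HessShapes (plaqsOf)
open NE3CovariantCalculus (hsR cDstar hsR_self)
open NE3CovariantWeitzenbock (frame)
open NE3GaugeDirFrames (Ad_Ad_inv)
open NE3QbarIterCovLiftPrep (cruxC)
open NE3RightInverseSolveLetters (thetaLoc)
open NE3HatInvCurlLetters (curl1C curl1C_nonneg)
open NE7CriticalFirstVariationGeneral (abs_dAction_le_of_tanCritical_general)
open NE7ExactCurrent (dAction_sub_tension_pairing_le)
open NE7CriticalTensionLetter (plaqsOf_periodBox isSkewDir_bump isPeriodicDir_bump dirL1_bump pairing_bump tension_mem_skewAdjoint norm_le_card_mul_of_hsR_le)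
open NE7FluxGradientFromTension (exists_fluxForm fluxForm_diag)
open NE7TensionGaugeLetter (norm_tension_gaugeAct norm_devForm_sub_fluxForm_le)
open NE7CovDivB8Letter (exists_devForm smul_covDiv_eq_tension_devForm norm_tension_devForm_sub_le)

noncomputable section

variable {d : ℕ} {n : Type*} [Fintype n] [DecidableEq n]

/-- **THE INTEGRATED TENSION LETTER OVER A GENERAL DATUM** (R2 of gen 72 with the general first-variation letter): for a unitary
`(N·L^{k+1})`-periodic `U` of the multi-level class (`LevelSmall`, `cruxC·M²x < 1`, `thetaLoc·M²x < 1`, `M²x ≤ 1`), plaquette radius `0 ≤ a ≤ 1∕4`, TANGENT-CRITICAL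
over its own (arbitrary) datum, and every skew periodic `Z`:
`|Σ_{y ∈ periodBox} Σ_ν hsR (frame U Z y ν) (T_ν(y))| ≤ (c_R·E·(L∕L^d)^{k+1} + 12·#Plane·a²)·‖Z‖_{ℓ¹(periodBox)}`, `T_ν(y) = Σ_μ cDstar U μ (B · μ ν) y`,
`c_R = a·(curl1C∕(1 − θ_loc M²x))·(M^d∕M²)`, `E` the explicit exponential of `NE7CriticalFirstVariationGeneral`. [folklore] -/
theorem abs_tension_pairing_le_of_tanCritical_gen [Nonempty n] {L : ℕ} (hL : 2 ≤ L) (k : ℕ) {N : ℕ} [NeZero N]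
    {U : Site d → Fin d → (Matrix n n ℂ)ˣ} {x a : ℝ}
    (hUu : IsUnitaryCfg U) (hUP : IsPeriodicCfg U ((N * L ^ (k + 1) : ℕ) : ℤ)) (hx : 0 ≤ x) (hs : LevelSmall d L k x) (hUx : SmallField U x)
    (hθ : cruxC d L * (((L : ℝ) ^ (k + 1)) ^ 2 * x) < 1) (hθl : thetaLoc d L * (((L : ℝ) ^ (k + 1)) ^ 2 * x) < 1)
    (hε : ((L : ℝ) ^ (k + 1)) ^ 2 * x ≤ 1) (ha : 0 ≤ a) (ha4 : a ≤ 1 / 4) (hUa : SmallField U a)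
    (hcrit : ∀ Y' : Site d → Fin d → Matrix n n ℂ, IsSkewDir Y' → IsPeriodicDir Y' ((N * L ^ (k + 1) : ℕ) : ℤ) →
      dirIter L (k + 1) U Y' = 0 → dAction U Y' (perWin d (N * L ^ (k + 1))) = 0)
    {B : Site d → Fin d → Fin d → Matrix n n ℂ}
    (hBF : ∀ (y : Site d) (μ ν : Fin d) (h : μ < ν), B y μ ν = flux U (y, ⟨(μ, ν), h⟩))
    (hanti : ∀ (y : Site d) (μ ν : Fin d), B y ν μ = -B y μ ν)
    {Z : Site d → Fin d → Matrix n n ℂ} (hZ : IsSkewDir Z) (hZP : IsPeriodicDir Z ((N * L ^ (k + 1) : ℕ) : ℤ)) :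
    |∑ y ∈ periodBox (d := d) (N * L ^ (k + 1)), ∑ ν : Fin d, hsR (frame U Z y ν) (∑ μ : Fin d, cDstar U μ (fun w => B w μ ν) y)|
      ≤ ((a * ((curl1C d L / (1 - thetaLoc d L * (((L : ℝ) ^ (k + 1)) ^ 2 * x))) * (((L : ℝ) ^ (k + 1)) ^ d / ((L : ℝ) ^ (k + 1)) ^ 2)))
            * (Real.exp (((L : ℝ) ^ d / L) * ((d : ℝ) * (16 * ((d : ℝ) + 1) * ((d : ℝ) + 4) * (L : ℝ) ^ 2)
              * (1250 * ((nbRad d L : ℝ) + L) + 8 * ((d : ℝ) * L) + 2 * L)) * (2 / twoLevelSmall d L))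
            * ((L : ℝ) / (L : ℝ) ^ d) ^ (k + 1))
          + 12 * (Fintype.card (T4AveragingDeficitWall.Plane d) : ℝ) * a ^ 2) * dirL1 Z (periodBox (d := d) (N * L ^ (k + 1))) := by
  have h1 := abs_dAction_le_of_tanCritical_general hL k hUu hUP hx hs hUx hθ hθl hε ha hUa hcrit hZ hZP
  have hP1 : 1 ≤ N * L ^ (k + 1) := Nat.one_le_iff_ne_zero.mpr (Nat.mul_ne_zero (NeZero.ne N) (pow_ne_zero _ (by omega)))
  have h2 := dAction_sub_tension_pairing_le hP1 hUu hUP ha ha4 hUa hZ hZP hBF hanti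
  rw [plaqsOf_periodBox] at h2
  have h3 := abs_sub_abs_le_abs_sub (∑ y ∈ periodBox (d := d) (N * L ^ (k + 1)), ∑ ν : Fin d,
      hsR (frame U Z y ν) (∑ μ : Fin d, cDstar U μ (fun w => B w μ ν) y)) (dAction U Z (perWin d (N * L ^ (k + 1))))
  rw [abs_sub_comm] at h2
  have h4 : |∑ y ∈ periodBox (d := d) (N * L ^ (k + 1)), ∑ ν : Fin d, hsR (frame U Z y ν) (∑ μ : Fin d, cDstar U μ (fun w => B w μ ν) y)|
      ≤ |dAction U Z (perWin d (N * L ^ (k + 1)))|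
        + 12 * (Fintype.card (T4AveragingDeficitWall.Plane d) : ℝ) * a ^ 2 * dirL1 Z (periodBox (d := d) (N * L ^ (k + 1))) := by
    linarith
  rw [add_mul]
  linarith [h1, h4]

/-- **THE POINTWISE TENSION LETTER OVER A GENERAL DATUM**: under the same hypotheses, at every bond `(x₀, ν₀)` of the period box
`‖Σ_μ cDstar U μ (B · μ ν₀) x₀‖ ≤ card n·(c_R·E·(L∕L^d)^{k+1} + 12·#Plane(d)·a²)` (one-bond test directions, as R2). [folklore] -/
theorem norm_tension_le_of_tanCritical_gen [Nonempty n] {L : ℕ} (hL : 2 ≤ L) (k : ℕ) {N : ℕ} [NeZero N]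
    {U : Site d → Fin d → (Matrix n n ℂ)ˣ} {x a : ℝ}
    (hUu : IsUnitaryCfg U) (hUP : IsPeriodicCfg U ((N * L ^ (k + 1) : ℕ) : ℤ)) (hx : 0 ≤ x) (hs : LevelSmall d L k x) (hUx : SmallField U x)
    (hθ : cruxC d L * (((L : ℝ) ^ (k + 1)) ^ 2 * x) < 1) (hθl : thetaLoc d L * (((L : ℝ) ^ (k + 1)) ^ 2 * x) < 1)
    (hε : ((L : ℝ) ^ (k + 1)) ^ 2 * x ≤ 1) (ha : 0 ≤ a) (ha4 : a ≤ 1 / 4) (hUa : SmallField U a)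
    (hcrit : ∀ Y' : Site d → Fin d → Matrix n n ℂ, IsSkewDir Y' → IsPeriodicDir Y' ((N * L ^ (k + 1) : ℕ) : ℤ) →
      dirIter L (k + 1) U Y' = 0 → dAction U Y' (perWin d (N * L ^ (k + 1))) = 0)
    {B : Site d → Fin d → Fin d → Matrix n n ℂ}
    (hBF : ∀ (y : Site d) (μ ν : Fin d), ∀ (h : μ < ν), B y μ ν = flux U (y, ⟨(μ, ν), h⟩))
    (hanti : ∀ (y : Site d) (μ ν : Fin d), B y ν μ = -B y μ ν)
    {x₀ : Site d} (hx₀ : x₀ ∈ periodBox (d := d) (N * L ^ (k + 1))) (ν₀ : Fin d) :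
    ‖∑ μ : Fin d, cDstar U μ (fun w => B w μ ν₀) x₀‖
      ≤ Fintype.card n *
          ((a * ((curl1C d L / (1 - thetaLoc d L * (((L : ℝ) ^ (k + 1)) ^ 2 * x))) * (((L : ℝ) ^ (k + 1)) ^ d / ((L : ℝ) ^ (k + 1)) ^ 2)))
              * (Real.exp (((L : ℝ) ^ d / L) * ((d : ℝ) * (16 * ((d : ℝ) + 1) * ((d : ℝ) + 4) * (L : ℝ) ^ 2)
              * (1250 * ((nbRad d L : ℝ) + L) + 8 * ((d : ℝ) * L) + 2 * L)) * (2 / twoLevelSmall d L))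
            * ((L : ℝ) / (L : ℝ) ^ d) ^ (k + 1))
            + 12 * (Fintype.card (T4AveragingDeficitWall.Plane d) : ℝ) * a ^ 2) := by
  -- the tension at the bond and the test matrix `X = Ad_{U(b)}⁻¹ T(b)`
  have hT : (∑ μ : Fin d, cDstar U μ (fun w => B w μ ν₀) x₀) ∈ skewAdjoint (Matrix n n ℂ) :=
    tension_mem_skewAdjoint hUu ha4 hUa hBF hanti x₀ ν₀
  have hu : U x₀ ν₀ ∈ unitaryUnits (Matrix n n ℂ) := hUu x₀ ν₀
  have hX : Ad (U x₀ ν₀)⁻¹ (∑ μ : Fin d, cDstar U μ (fun w => B w μ ν₀) x₀) ∈ skewAdjoint (Matrix n n ℂ) :=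
    Ad_mem_skewAdjoint ((unitaryUnits _).inv_mem hu) hT
  -- the integrated letter on the one-bond direction
  have hA := abs_tension_pairing_le_of_tanCritical_gen hL k hUu hUP hx hs hUx hθ hθl hε ha ha4 hUa hcrit hBF hanti
    (isSkewDir_bump (N * L ^ (k + 1)) x₀ ν₀ hX) (isPeriodicDir_bump (N * L ^ (k + 1)) x₀ ν₀ _)
  rw [pairing_bump U hx₀ ν₀ _ (fun y ν => ∑ μ : Fin d, cDstar U μ (fun w => B w μ ν) y), dirL1_bump hx₀, Ad_Ad_inv,
    norm_Ad_of_unitary ((unitaryUnits _).inv_mem hu)] at hA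
  -- nonnegativity of the constant
  have hK : 0 ≤ (a * ((curl1C d L / (1 - thetaLoc d L * (((L : ℝ) ^ (k + 1)) ^ 2 * x))) * (((L : ℝ) ^ (k + 1)) ^ d / ((L : ℝ) ^ (k + 1)) ^ 2)))
        * (Real.exp (((L : ℝ) ^ d / L) * ((d : ℝ) * (16 * ((d : ℝ) + 1) * ((d : ℝ) + 4) * (L : ℝ) ^ 2)
              * (1250 * ((nbRad d L : ℝ) + L) + 8 * ((d : ℝ) * L) + 2 * L)) * (2 / twoLevelSmall d L))
            * ((L : ℝ) / (L : ℝ) ^ d) ^ (k + 1))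
      + 12 * (Fintype.card (T4AveragingDeficitWall.Plane d) : ℝ) * a ^ 2 := by
    have hpos : 0 < 1 - thetaLoc d L * (((L : ℝ) ^ (k + 1)) ^ 2 * x) := by linarith
    have := curl1C_nonneg d L
    positivity
  exact norm_le_card_mul_of_hsR_le hK ((le_abs_self _).trans hA)

/-- **THE TENSION LETTER IN ANY UNITARY GAUGE, GENERAL DATUM** (R3 of gen 72): the same bound for the flux form `B′` of `U^{u}`, every unitary site gauge `u`.
[folklore] -/
theorem norm_tension_gaugeAct_le_of_tanCritical_gen [Nonempty n] {L : ℕ} (hL : 2 ≤ L) (k : ℕ) {N : ℕ} [NeZero N]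
    {U : Site d → Fin d → (Matrix n n ℂ)ˣ} {x a : ℝ}
    (hUu : IsUnitaryCfg U) (hUP : IsPeriodicCfg U ((N * L ^ (k + 1) : ℕ) : ℤ)) (hx : 0 ≤ x) (hs : LevelSmall d L k x) (hUx : SmallField U x)
    (hθ : cruxC d L * (((L : ℝ) ^ (k + 1)) ^ 2 * x) < 1) (hθl : thetaLoc d L * (((L : ℝ) ^ (k + 1)) ^ 2 * x) < 1)
    (hε : ((L : ℝ) ^ (k + 1)) ^ 2 * x ≤ 1) (ha : 0 ≤ a) (ha4 : a ≤ 1 / 4) (hUa : SmallField U a)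
    (hcrit : ∀ Y' : Site d → Fin d → Matrix n n ℂ, IsSkewDir Y' → IsPeriodicDir Y' ((N * L ^ (k + 1) : ℕ) : ℤ) →
      dirIter L (k + 1) U Y' = 0 → dAction U Y' (perWin d (N * L ^ (k + 1))) = 0)
    {u : Site d → (Matrix n n ℂ)ˣ} (hu : ∀ x, u x ∈ unitaryUnits (Matrix n n ℂ))
    {B' : Site d → Fin d → Fin d → Matrix n n ℂ}
    (hBF' : ∀ (y : Site d) (μ ν : Fin d) (h : μ < ν), B' y μ ν = flux (gaugeAct u U) (y, ⟨(μ, ν), h⟩))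
    (hanti' : ∀ (y : Site d) (μ ν : Fin d), B' y ν μ = -B' y μ ν)
    {x₀ : Site d} (hx₀ : x₀ ∈ periodBox (d := d) (N * L ^ (k + 1))) (ν₀ : Fin d) :
    ‖∑ μ : Fin d, cDstar (gaugeAct u U) μ (fun w => B' w μ ν₀) x₀‖
      ≤ Fintype.card n *
          ((a * ((curl1C d L / (1 - thetaLoc d L * (((L : ℝ) ^ (k + 1)) ^ 2 * x))) * (((L : ℝ) ^ (k + 1)) ^ d / ((L : ℝ) ^ (k + 1)) ^ 2)))
              * (Real.exp (((L : ℝ) ^ d / L) * ((d : ℝ) * (16 * ((d : ℝ) + 1) * ((d : ℝ) + 4) * (L : ℝ) ^ 2)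
              * (1250 * ((nbRad d L : ℝ) + L) + 8 * ((d : ℝ) * L) + 2 * L)) * (2 / twoLevelSmall d L))
            * ((L : ℝ) / (L : ℝ) ^ d) ^ (k + 1))
            + 12 * (Fintype.card (T4AveragingDeficitWall.Plane d) : ℝ) * a ^ 2) := by
  obtain ⟨B, hBF, hanti⟩ := exists_fluxForm U
  rw [norm_tension_gaugeAct hu ha4 hUa hBF hanti hBF' hanti']
  exact norm_tension_le_of_tanCritical_gen hL k hUu hUP hx hs hUx hθ hθl hε ha ha4 hUa hcrit hBF hanti hx₀ ν₀

/-- **[B8] (1.9) ∕ [B11] (2)'s CURRENT CLAUSE FOR OUR TANGENT-CRITICAL CONFIGURATIONS, GENERAL DATUM** (R4 of gen 72): for every unitary site gauge `u` and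
`η ≠ 0`, `‖B8Ineq132.covDiv η (U^{u}) μ x₀‖ ≤ |η|⁻¹·(card n·(c_R·E·(L∕L^d)^{k+1} + 12·#Plane·a²) + 8d·a²)` at every bond of the period box — with `η = M⁻¹`,
`a = δM⁻²`: `≲ δ·M⁻²·(constants)`, the threshold shape `α(L^j)^{−2}(L^jη)^{−1}` of `B8Ineq132.CondAt` at the top level. [folklore] -/
theorem norm_covDiv_le_of_tanCritical_gen [Nonempty n] {L : ℕ} (hL : 2 ≤ L) (k : ℕ) {N : ℕ} [NeZero N]
    {U : Site d → Fin d → (Matrix n n ℂ)ˣ} {x a : ℝ}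
    (hUu : IsUnitaryCfg U) (hUP : IsPeriodicCfg U ((N * L ^ (k + 1) : ℕ) : ℤ)) (hx : 0 ≤ x) (hs : LevelSmall d L k x) (hUx : SmallField U x)
    (hθ : cruxC d L * (((L : ℝ) ^ (k + 1)) ^ 2 * x) < 1) (hθl : thetaLoc d L * (((L : ℝ) ^ (k + 1)) ^ 2 * x) < 1)
    (hε : ((L : ℝ) ^ (k + 1)) ^ 2 * x ≤ 1) (ha : 0 ≤ a) (ha4 : a ≤ 1 / 4) (hUa : SmallField U a)
    (hcrit : ∀ Y' : Site d → Fin d → Matrix n n ℂ, IsSkewDir Y' → IsPeriodicDir Y' ((N * L ^ (k + 1) : ℕ) : ℤ) →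
      dirIter L (k + 1) U Y' = 0 → dAction U Y' (perWin d (N * L ^ (k + 1))) = 0)
    {u : Site d → (Matrix n n ℂ)ˣ} (hu : ∀ x, u x ∈ unitaryUnits (Matrix n n ℂ)) {η : ℝ} (hη : η ≠ 0)
    {x₀ : Site d} (hx₀ : x₀ ∈ periodBox (d := d) (N * L ^ (k + 1))) (μ : Fin d) :
    ‖covDiv η (gaugeAct u U) μ x₀‖
      ≤ |η|⁻¹ * (Fintype.card n *
          ((a * ((curl1C d L / (1 - thetaLoc d L * (((L : ℝ) ^ (k + 1)) ^ 2 * x))) * (((L : ℝ) ^ (k + 1)) ^ d / ((L : ℝ) ^ (k + 1)) ^ 2)))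
              * (Real.exp (((L : ℝ) ^ d / L) * ((d : ℝ) * (16 * ((d : ℝ) + 1) * ((d : ℝ) + 4) * (L : ℝ) ^ 2)
              * (1250 * ((nbRad d L : ℝ) + L) + 8 * ((d : ℝ) * L) + 2 * L)) * (2 / twoLevelSmall d L))
            * ((L : ℝ) / (L : ℝ) ^ d) ^ (k + 1))
            + 12 * (Fintype.card (T4AveragingDeficitWall.Plane d) : ℝ) * a ^ 2) + 8 * (d : ℝ) * a ^ 2) := by
  obtain ⟨B', hBF', hanti'⟩ := exists_fluxForm (gaugeAct u U)
  obtain ⟨D', hDF', hDanti'⟩ := exists_devForm (gaugeAct u U)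
  have hVu : IsUnitaryCfg (gaugeAct u U) := isUnitaryCfg_gaugeAct hu hUu
  have hVa : SmallField (gaugeAct u U) a := smallField_gaugeAct hu hUa
  have hT := norm_tension_gaugeAct_le_of_tanCritical_gen hL k hUu hUP hx hs hUx hθ hθl hε ha ha4 hUa hcrit hu hBF' hanti' hx₀ μ
  have hDB := norm_tension_devForm_sub_le hVu ha4 hVa hBF' hanti' hDF' hDanti' x₀ μ
  have hid := smul_covDiv_eq_tension_devForm (V := gaugeAct u U) hη hDF' hDanti' μ x₀
  have hnorm : ‖covDiv η (gaugeAct u U) μ x₀‖ = |η|⁻¹ * ‖∑ ν : Fin d, cDstar (gaugeAct u U) ν (fun w => D' w ν μ) x₀‖ := by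
    rw [← hid, norm_smul, Real.norm_eq_abs, ← mul_assoc, inv_mul_cancel₀ (abs_ne_zero.mpr hη), one_mul]
  rw [hnorm]
  refine mul_le_mul_of_nonneg_left ?_ (inv_nonneg.mpr (abs_nonneg η))
  have h3 := norm_le_norm_add_norm_sub' (∑ ν : Fin d, cDstar (gaugeAct u U) ν (fun w => D' w ν μ) x₀)
    (∑ ν : Fin d, cDstar (gaugeAct u U) ν (fun w => B' w ν μ) x₀)
  linarith


end

end Summit.QuantumFields.BalabanUV.T4Continuum.NE7CovDivGeneralDatum
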